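import Summits.BirchSwinnertonDyer.BirchSwinnertonDyer.Theorems.SignedLowerHalvesSmallImageLowerHalfBothSignsRttD2SeqJ3HControl
import Summits.BirchSwinnertonDyer.BirchSwinnertonDyer.Theorems.SignedLowerHalvesSmallImageLowerHalfBothSignsRttD2SeqJ3HLayerSolve
import Summits.BirchSwinnertonDyer.BirchSwinnertonDyer.Theorems.SignedLowerHalvesSmallImageLowerHalfBothSignsRttD2SeqJ3RSeqCofree
import HarnessLib

/-!
# Route `SignedLowerHalves`, crux L `SmallImageLowerHalfBothSigns` (stmt-BirchSwinnertonDyer-23599), line `rtt_w3` v16–v20 — E2, row J3 residual: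
# ★★★ `hsolL` PROVED (finite-level Poitou–Tate solvability in the junction currency) and J3 — `exists_junction_exact_cofree_lam_seq` (g22, p792377) —
# WITH BOTH ITS MATHEMATICAL INPUTS `RSeq` (g23, p795300/p795664) AND `hsolL` (this file) DISCHARGED, for the LEAD's `M = Cofree θ F` and the `λ`-pairings

WIDTH seat `bsd-line-slh-p3-w3` g24 under LEAD `cruxlead-stmt-BirchSwinnertonDyer-23599` g12 (cell `bsd-ssimc`); helper `--supports stmt-BirchSwinnertonDyer-23599`.
THEOREMS ONLY (no definition, no named fact, no instance, no `sorry`). HONEST FRAMING: J3 (`j₀ : B′ →ₗ[Λ_𝒪] DQ.X` on the strict carrier with `toDual ∘ j₀ = strictPairing`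
and `Function.Exact j₀ gX`) now holds for the LEAD's module MODULO ONLY THE SIDE HYPOTHESES listed below — no `RSeq`, no `hsolL`, no `hH0`. The remaining hypotheses are
about the FRAME, not about Poitou–Tate: `K` totally complex; `v` the only place above `p` (`hpv`, `hvp`), non-split in `K_∞` (`hv`); `P = S₀ ∪ {v}` (`hvP`, `hS₀P`, `hPS₀`),
`v ∉ S₀`, `P`, `S₀` finite; `K_∞/K` unramified outside `P` (`hNP`); inertia off `P` trivial on `M` (`hMP`, = R8 p795807 from `θ` unramified off `P`); the `Γ_{K_v}`-action IS
`localAction` (`hinst`); and PERFECTNESS of the level pairings `X_m × M[p^m] → μ_{p^m}` (`hperf`, a condition on `λ` and on `X_m = (𝒪/p^m ⊗ μ_{p^m} ⊗ θ′)^{N_P}`).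
E2, crux L, crux M, BSD remain OPEN and are proved for NO curve.

* ★★★ `exists_mem_strictLevel_locPairNK_eq_of_hq` — `hsolL` at level `m` for generic `M` under `localAction` and restricted global pairings: H7a (p800127) + H5b (`horth_of_hq`).
* ★★★ `hsolL_cofree_lam` — the `hsolL` binder of `exists_junction_exact_cofree_lam_of_hsolL` (p795664) VERBATIM for `M = Cofree θ F`, `Pk = cofreeLamCoeffPairing`.
* ★★★ `exists_junction_exact_cofree_lam` — J3 for the LEAD's data: p795664 with `hsolL` discharged.
References: [Kobayashi2003] Thm. 7.3 i); [MilneADT2006] I Thm. 4.10 (b); [Rubin2000] Thm. 1.7.3, §4.2; [NeukirchSchmidtWingberg2008] VIII §6, (8.6.2)–(8.6.3), (7.2.6);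
[Kato2004Asterisque] §17.13; [PerrinRiou1987] §4.
-/

set_option autoImplicit false
set_option linter.dupNamespace false -- D-0017: single-problem summit, the namespace repeats the problem name by design
noncomputable section

open scoped Classical
open NumberField IsDedekindDomain Field Matrix CategoryTheory Function

namespace Summit.BirchSwinnertonDyer.BirchSwinnertonDyer.Theorems.SmallImageRttD2Seq

open Literature.NumberTheory.EllipticCurves Literature.NumberTheory.EllipticCurves.GreenbergSelmer Literature.NumberTheory.GaloisRepresentations
  Literature.NumberTheory.GaloisRepresentations.DiscreteGaloisModule Literature.NumberTheory.GaloisCohomology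
  Literature.NumberTheory.EllipticCurves.GreenbergVatsal2000 Literature.NumberTheory.ComplexMultiplication.EllipticUnits.JohnsonLeungKings2011
  Summit.BirchSwinnertonDyer.BirchSwinnertonDyer.Theorems.SmallImageCharSignedSelmer Summit.BirchSwinnertonDyer.BirchSwinnertonDyer.Theorems.SmallImageRttD2J1

/-! ## §1. `hsolL` for generic `M` and restricted global pairings -/

section Generic

variable {K : Type} [Field K] [NumberField K] {p : ℕ} [Fact p.Prime] (S : Set (PadicAlgCl p)) [FiniteDimensional ℚ_[p] (padicCoeffField S)] (κ : ZpExtension K p)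
  (θ' : absoluteGaloisGroup K →ₜ* (padicCoeffIntegers S)ˣ) (P : Set (HeightOneSpectrum (𝓞 K))) (v : HeightOneSpectrum (𝓞 K))
  (M : Type) [AddCommGroup M] [TopologicalSpace M] [DiscreteTopology M] [DistribMulAction (absoluteGaloisGroup K) M]
  [Module (padicCoeffIntegers S) M]
  (hstabK : ∀ m : M, IsOpen (MulAction.stabilizer (absoluteGaloisGroup K) m : Set (absoluteGaloisGroup K)))

/-- ★★★ **`hsolL` at level `m` — finite-level Poitou–Tate SOLVABILITY in the junction currency, PROVED.** For a character `q : E^ε_{sat,v} → ℚ/ℤ` killing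
`loc_v(Sel^{ε,S₀}_𝒪(K_∞, M))`, some class `y` of the strict set `strictLevel S κ θ′ P S₀ m m` has `locPairNK … m m y ℓ = q ⟨ℓ⟩` for every good `ℓ` — H7a
(`exists_mem_strictLevel_locPairNK_eq_of_orth`, Poitou–Tate solvability at the layer `K̄^{U_m}` for THE canonical maps + descent + strictness) with its layer-orthogonality
hypothesis supplied by H5b (`horth_of_hq`, control in the local tower). Generic discrete `p`-power-torsion-free-of-hypotheses `M` with open stabilisers, `Γ_{K_v}`-action `localAction`,
pairings restricted from a global family `PG`. [cite: Kobayashi2003, Thm. 7.3 i)] [cite: MilneADT2006, Ch. I, Thm. 4.10(b)] [cite: Rubin2000, Thm. 1.7.3, §4.2]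
[cite: NeukirchSchmidtWingberg2008, (8.6.2)–(8.6.3)] -/
theorem exists_mem_strictLevel_locPairNK_eq_of_hq (V : WeierstrassCurve K) (j : V.geomPrimaryTorsion p →+ M) (S₀ : Set (HeightOneSpectrum (𝓞 K))) (ε : ℤˣ)
    (PG : ∀ k : ℕ, ContPairing (coeffRepK S θ' P k).toTopRep (torsRep M hstabK p k).toTopRep (mu K (p ^ k)).toTopRep)
    (hS₀ : S₀.Finite) (hvS₀ : v ∉ S₀) (hvP : v ∈ P) (hS₀P : S₀ ⊆ P) (hPS₀ : ∀ w ∈ P, w ∉ S₀ → w = v)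
    (hvp : ((p : ℕ) : 𝓞 K) ∈ v.asIdeal) (hpv : ∀ w : HeightOneSpectrum (𝓞 K), ((p : ℕ) : 𝓞 K) ∈ w.asIdeal → w = v)
    (hNP : ∀ n, ramificationSubgroup K P ≤ κ.layerSubgroup n) (hv : AcSigned.IsNonsplitIn κ v)
    (hstab : letI := localAction (closureEmb (K := K) (v.adicCompletion K)) M
      ∀ m : M, IsOpen (MulAction.stabilizer (absoluteGaloisGroup (v.adicCompletion K)) m : Set (absoluteGaloisGroup (v.adicCompletion K))))
    (q : letI := localAction (closureEmb (K := K) (v.adicCompletion K)) M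
      localCondInftySat κ M (padicCoeffIntegers S) V j ε v →+ AddCircle (1 : ℚ))
    (hq : letI := localAction (closureEmb (K := K) (v.adicCompletion K)) M
      ∀ s : signedTransportSelmerInftySat κ M (padicCoeffIntegers S) V j S₀ ε,
        q (locSat κ M (padicCoeffIntegers S) V j S₀ ε v (fun _ _ ↦ rfl) hvp s) = 0)
    (m : ℕ) (hperf : Bijective fun a : ↥(torsionPow M p m) ↦ (PG m).toLin.flip a) :
    letI := localAction (closureEmb (K := K) (v.adicCompletion K)) M
    ∃ y ∈ strictLevel S κ θ' P S₀ m m,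
      ∀ (ℓ : subgroupH1 (localSubgroupOfEmb (κ.layerSubgroup m) (closureEmb (K := K) (v.adicCompletion K))) ↥(torsionPow M p m))
        (hℓ : ℓ ∈ goodLevel S κ v M V j ε m m),
        locPairNK S κ θ' P v M hstab (fun k ↦ resPairingAt K (p ^ k) (coeffRepK S θ' P k) (torsRep M hstabK p k) (PG k) v) m m y ℓ = q ⟨_, hℓ⟩ :=
  exists_mem_strictLevel_locPairNK_eq_of_orth S κ θ' P v M hstabK V j S₀ ε PG hS₀ hvS₀ hvP hS₀P hPS₀ hpv hNP hv hstab q m hperf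
    fun c hcur hc ↦ horth_of_hq S κ v M hstabK V j S₀ ε hvp hpv hv hstab q hq m c hcur hc

end Generic

/-! ## §2. The LEAD's module `M = Cofree θ F`: `hsolL` and J3 -/

section Cofree

variable {K : Type} [Field K] [NumberField K] {p : ℕ} [Fact p.Prime] {κ : ZpExtension K p} {γ : absoluteGaloisGroup K}
  (S : Set (PadicAlgCl p)) [FiniteDimensional ℚ_[p] (padicCoeffField S)] (lam : padicCoeffIntegers S →+ ℤ_[p])
  (hlam : ∀ (c : ℤ_[p]) (y : padicCoeffIntegers S), lam (padicIntToCoeffIntegers S c * y) = c * lam y)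
  (θ : FramedGaloisRep K (padicCoeffIntegers S) 1)
  {V : WeierstrassCurve K} {j : V.geomPrimaryTorsion p →+ Cofree θ (padicCoeffField S)} {S₀ : Set (HeightOneSpectrum (𝓞 K))} {ε : ℤˣ}
  (D : SignedTransportDualDataSat κ γ (Cofree θ (padicCoeffField S)) (padicCoeffIntegers S) V j S₀ ε)
  {v : HeightOneSpectrum (𝓞 K)} [inst : DistribMulAction (absoluteGaloisGroup (v.adicCompletion K)) (Cofree θ (padicCoeffField S))]
  [SMulCommClass (absoluteGaloisGroup (v.adicCompletion K)) (padicCoeffIntegers S) (Cofree θ (padicCoeffField S))]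
  {γv : absoluteGaloisGroup (v.adicCompletion K)} (DQ : LocalCondDualData κ (Cofree θ (padicCoeffField S)) (padicCoeffIntegers S) V j ε v γv)
  (hres : ∀ (σ : absoluteGaloisGroup (v.adicCompletion K)) (m : Cofree θ (padicCoeffField S)), σ • m = resGalOfEmb (closureEmb (K := K) (v.adicCompletion K)) σ • m)
  (hvp : (p : 𝓞 K) ∈ v.asIdeal)
  {γB : absoluteGaloisGroup K} {θ' : absoluteGaloisGroup K →ₜ* (padicCoeffIntegers S)ˣ} {P : Set (HeightOneSpectrum (𝓞 K))}
  (I : CycIwasawaCohomologyDataO S κ γB θ' P 1)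
  (hstab : ∀ m : Cofree θ (padicCoeffField S),
    IsOpen (MulAction.stabilizer (absoluteGaloisGroup (v.adicCompletion K)) m : Set (absoluteGaloisGroup (v.adicCompletion K))))
  (hθ : ∀ σ : absoluteGaloisGroup K,
    ((θ' σ : (padicCoeffIntegers S)ˣ) : padicCoeffIntegers S) * ((θ σ : GL (Fin 1) (padicCoeffIntegers S)) : Matrix (Fin 1) (Fin 1) (padicCoeffIntegers S)) 0 0 = 1)
  (htor : ∀ m : Cofree θ (padicCoeffField S), ∃ k : ℕ, p ^ k • m = 0)
  (hγB : γB * resGalOfEmb (closureEmb (K := K) (v.adicCompletion K)) γv ∈ κ.kerSubgroup)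
  (hNP : ∀ n, ramificationSubgroup K P ≤ κ.layerSubgroup n) (hv : AcSigned.IsNonsplitIn κ v)

include hNP hv in
/-- ★★★ **`hsolL` FOR `M = Cofree θ F` AND THE `λ`-PAIRINGS** — the hypothesis `hsolL` of `exists_junction_exact_cofree_lam_of_hsolL` (p795664) VERBATIM (any `hres`, the
instance pinned by `hinst`), from perfectness of the level pairings (`hperf`) and the frame hypotheses. The pairings `cofreeLamCoeffPairing` ARE the restrictions of the global
`cofreeLamCoeffPairingK` (definitionally), so §1 applies. [cite: Kobayashi2003, Thm. 7.3 i)] [cite: MilneADT2006, Ch. I, Thm. 4.10(b)] [cite: Rubin2000, Thm. 1.7.3, §4.2] -/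
theorem hsolL_cofree_lam (hinst : inst = localAction (closureEmb (K := K) (v.adicCompletion K)) (Cofree θ (padicCoeffField S)))
    (hstabK : ∀ m : Cofree θ (padicCoeffField S), IsOpen (MulAction.stabilizer (absoluteGaloisGroup K) m : Set (absoluteGaloisGroup K)))
    (hS₀ : S₀.Finite) (hvS₀ : v ∉ S₀) (hvP : v ∈ P) (hS₀P : S₀ ⊆ P) (hPS₀ : ∀ w ∈ P, w ∉ S₀ → w = v)
    (hpv : ∀ w : HeightOneSpectrum (𝓞 K), ((p : ℕ) : 𝓞 K) ∈ w.asIdeal → w = v)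
    (hperf : ∀ m : ℕ, Bijective fun a : ↥(torsionPow (Cofree θ (padicCoeffField S)) p m) ↦ (cofreeLamCoeffPairingK S lam hlam θ' P θ hstabK hθ m).toLin.flip a)
    (q : localCondInftySat κ (Cofree θ (padicCoeffField S)) (padicCoeffIntegers S) V j ε v →+ AddCircle (1 : ℚ))
    (hq : ∀ s : signedTransportSelmerInftySat κ (Cofree θ (padicCoeffField S)) (padicCoeffIntegers S) V j S₀ ε,
      q (locSat κ (Cofree θ (padicCoeffField S)) (padicCoeffIntegers S) V j S₀ ε v hres hvp s) = 0) (m : ℕ) :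
    ∃ y ∈ strictLevel S κ θ' P S₀ m m,
      ∀ (ℓ : subgroupH1 (localSubgroupOfEmb (κ.layerSubgroup m) (closureEmb (K := K) (v.adicCompletion K))) ↥(torsionPow (Cofree θ (padicCoeffField S)) p m))
        (hℓ : ℓ ∈ goodLevel S κ v (Cofree θ (padicCoeffField S)) V j ε m m),
        locPairNK S κ θ' P v (Cofree θ (padicCoeffField S)) hstab (cofreeLamCoeffPairing S lam hlam θ' P v θ hres hstab hθ) m m y ℓ = q ⟨_, hℓ⟩ := by
  subst hinst
  exact exists_mem_strictLevel_locPairNK_eq_of_hq S κ θ' P v (Cofree θ (padicCoeffField S)) hstabK V j S₀ ε (cofreeLamCoeffPairingK S lam hlam θ' P θ hstabK hθ)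
    hS₀ hvS₀ hvP hS₀P hPS₀ hvp hpv hNP hv hstab q hq m (hperf m)

include htor hv in
/-- ★★★ **J3 FOR THE LEAD's `M = Cofree θ F` — `RSeq` AND `hsolL` BOTH DISCHARGED.** There is `j₀ : B′ →ₗ[Λ_𝒪] DQ.X` on the strict carrier `B′` with
`toDual ∘ j₀ = strictPairing …` and `Function.Exact j₀ gX` (`exists_junction_exact_cofree_lam_seq`, g22 p792377), given ONLY the frame hypotheses: `K` totally complex,
`v` the only place above `p` and non-split in `K_∞`, `P = S₀ ∪ {v}` finite with `v ∉ S₀`, `K_∞/K` unramified outside `P`, inertia off `P` trivial on `M`, the `Γ_{K_v}`-action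
`localAction`, and perfectness of the level pairings `X_m × M[p^m] → μ_{p^m}` of `cofreeLamCoeffPairingK`. [cite: Kobayashi2003, Thm. 7.3 i)] [cite: Rubin2000, Thm. 1.7.3, §4.2]
[cite: NeukirchSchmidtWingberg2008, VIII §6, (7.2.6)] [cite: MilneADT2006, Ch. I, Thm. 4.10(b)] [cite: Kato2004Asterisque, §17.13] -/
theorem exists_junction_exact_cofree_lam [IsTotallyComplex K]
    (hinst : inst = localAction (closureEmb (K := K) (v.adicCompletion K)) (Cofree θ (padicCoeffField S)))
    (instX : Module (IwasawaAlgebraO S) D.X) (instQ : Module (IwasawaAlgebraO S) DQ.X)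
    (hιX : ∀ (f : IwasawaAlgebra p) (x : D.X), (letI := instX; iwasawaToIwasawaO S f • x) = f • x)
    (hιQ : ∀ (f : IwasawaAlgebra p) (x : DQ.X), (letI := instQ; iwasawaToIwasawaO S f • x) = f • x)
    (hCX : ∀ (a : padicCoeffIntegers S) (x : D.X) (s : signedTransportSelmerInftySat κ (Cofree θ (padicCoeffField S)) (padicCoeffIntegers S) V j S₀ ε),
      D.toDual (letI := instX; (PowerSeries.C a : IwasawaAlgebraO S) • x) s =
        D.toDual x ⟨GreenbergSelmer.scalarH1 κ.kerSubgroup (Cofree θ (padicCoeffField S)) a s,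
          scalarH1_mem_signedTransportSelmerInftySat κ (Cofree θ (padicCoeffField S)) (padicCoeffIntegers S) V j S₀ ε a s.2⟩)
    (hCQ : ∀ (a : padicCoeffIntegers S) (x : DQ.X) (c : localCondInftySat κ (Cofree θ (padicCoeffField S)) (padicCoeffIntegers S) V j ε v),
      DQ.toDual (letI := instQ; (PowerSeries.C a : IwasawaAlgebraO S) • x) c = DQ.toDual x (scalarLocalSat κ (Cofree θ (padicCoeffField S)) (padicCoeffIntegers S) V j ε v a c))
    (hstabK : ∀ m : Cofree θ (padicCoeffField S), IsOpen (MulAction.stabilizer (absoluteGaloisGroup K) m : Set (absoluteGaloisGroup K)))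
    (hγ : κ.IsTopGenerator γ) (hγv : κ.IsTopGenerator (resGalOfEmb (closureEmb (K := K) (v.adicCompletion K)) γv)) (hP : P.Finite)
    (hS₀ : S₀.Finite) (hPS₀ : ∀ w ∈ P, w ∉ S₀ → w = v) (hpv : ∀ w : HeightOneSpectrum (𝓞 K), ((p : ℕ) : 𝓞 K) ∈ w.asIdeal → w = v)
    (hMP : ∀ w : HeightOneSpectrum (𝓞 K), w ∉ P → ∀ 𝔓 ∈ w.primesAbove, ∀ τ ∈ 𝔓.inertia (absoluteGaloisGroup K), ∀ m : Cofree θ (padicCoeffField S), τ • m = m)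
    (hvS₀ : v ∉ S₀) (hvP : v ∈ P) (hS₀P : S₀ ⊆ P)
    (hperf : ∀ m : ℕ, Bijective fun a : ↥(torsionPow (Cofree θ (padicCoeffField S)) p m) ↦ (cofreeLamCoeffPairingK S lam hlam θ' P θ hstabK hθ m).toLin.flip a) :
    letI := instX; letI := instQ
    ∃ j₀ : strictCarrier I (strictLevel S κ θ' P S₀) (fun n k f _ hy ↦ smul_mem_strictLevel S κ θ' P S₀ γB n k f hy) →ₗ[IwasawaAlgebraO S] DQ.X,
      (∀ b, DQ.toDual (j₀ b) = strictPairing (layerPairingOf S κ θ' P v (Cofree θ (padicCoeffField S)) hstab (cofreeLamCoeffPairing S lam hlam θ' P v θ hres hstab hθ) htor γB γv hγB hNP hv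
        (cofreeLamCoeffPairing_hPred S lam hlam θ' P v θ hres hstab hθ) (cofreeLamCoeffPairing_hPsc S lam hlam θ' P v θ hres hstab hθ)) I (strictLevel S κ θ' P S₀)
        (fun n k f _ hy ↦ smul_mem_strictLevel S κ θ' P S₀ γB n k f hy) hstab b) ∧
      Function.Exact j₀ (gXLinearMapO S D DQ hres hvp instX instQ hιX hιQ hCX hCQ htor hstabK hstab hγ hv hγv) :=
  exists_junction_exact_cofree_lam_of_hsolL S lam hlam θ D DQ hres hvp I hstab hθ htor hγB hNP hv hinst instX instQ hιX hιQ hCX hCQ hstabK hγ hγv hP hS₀ hPS₀ hpv hMP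
    (hsolL_cofree_lam S lam hlam θ hres hvp hstab hθ hNP hv hinst hstabK hS₀ hvS₀ hvP hS₀P hPS₀ hpv hperf)

end Cofree

end Summit.BirchSwinnertonDyer.BirchSwinnertonDyer.Theorems.SmallImageRttD2Seq

end
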